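import Summits.AtomisticToContinuum.Crystallization.Theorems.ExcessDecayLiouvilleScaleArithTheta

/-!
# Route `ExcessDecayLiouville`: scaling form of the named currencies (root variables)

Harmonic-replacement architecture for item `ExcessDecay` (stmt-AtomisticToContinuum-9334), nonlinear half.
Pure real-variable inequalities bounding the named currencies of `ExcessDecayLiouvilleScaleDefs` by monomials in the
scale `ρ`, the mass constant `C`, the matching radius `r`, the crude bound `Du`, the forcing floor `Φ = phiOf Du r δ`
and the global gradient bound `N`, with every numerical constant absorbed into powers of the level constant
`L = lcOf κ ≥ 2.39·10⁸` (`1/κ ≤ L`).  This file: the square-root forms in `σ = √ρ`, `γ = √C`, `ν = √(N/r⁷)` and the monotone jump bound.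
All `[folklore]`; helper lemmas, nothing here closes an item.
-/

noncomputable section

namespace Summit.AtomisticToContinuum.Crystallization.Theorems.ExcessDecayLiouville

/-! ## Stage-2 arithmetic, part 7: square-root forms in `σ = √ρ`, `γ = √C`, `ν = √(N/r⁷)` -/

/-- `√x ≤ a + b + c + d` if `x ≤ M (a² + b² + c² + d²)`-free form: `x ≤ a² + b² + c² + d²`. [folklore] -/
theorem sqrt_le_add_four {x a b c d : ℝ} (ha : 0 ≤ a) (hb : 0 ≤ b) (hc : 0 ≤ c) (hd : 0 ≤ d)
    (h : x ≤ a ^ 2 + b ^ 2 + c ^ 2 + d ^ 2) : Real.sqrt x ≤ a + b + c + d := by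
  rw [Real.sqrt_le_iff]
  refine ⟨by positivity, h.trans ?_⟩
  nlinarith [mul_nonneg ha hb, mul_nonneg ha hc, mul_nonneg ha hd, mul_nonneg hb hc, mul_nonneg hb hd, mul_nonneg hc hd]

/-- Nonnegativity of the forcing floor. [folklore] -/
theorem phiOf_nonneg {Du r δ : ℝ} (hDu : 0 ≤ Du) (hr : 0 < r) (hδ : 0 < δ) : 0 ≤ phiOf Du r δ := by
  unfold phiOf; positivity

/-- **`√Θ₁` in the root variables**: `√Θ₁ ≤ L⁸ (γσ + σ²Φ + Du/(σr²) + σ²ν)`. [folklore] -/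
theorem sqrt_thetaOne_le {κ σ γ r δ Du j b ν : ℝ} (hκ : 0 < κ) (hκ1 : κ ≤ 1) (hσ : 8 ≤ σ) (hσr : σ ^ 2 ≤ r)
    (hγ : 0 ≤ γ) (hr : 1 ≤ r) (hδ : 0 < δ) (hDu : 0 ≤ Du) (hj : 0 ≤ j) (hb : 0 ≤ b) (hΛ1 : lamOf Du j b ≤ 1)
    (hν : 0 ≤ ν) :
    Real.sqrt (thetaOneOf κ (σ ^ 2) (γ ^ 2) r δ Du Du j b (ν ^ 2 * r ^ 7)) ≤
      lcOf κ ^ 8 * (γ * σ + σ ^ 2 * phiOf Du r δ + Du / (σ * r ^ 2) + σ ^ 2 * ν) := by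
  have hσ0 : 0 < σ := by linarith
  have hr0 : 0 < r := by linarith
  obtain ⟨hL, -, -⟩ := lcOf_ge hκ hκ1
  have hL0 : 0 ≤ lcOf κ := le_trans (by norm_num) hL
  have hΦ0 := phiOf_nonneg hDu hr0 hδ
  have h := thetaOneOf_le (δ := δ) hκ hκ1 (by nlinarith : (64 : ℝ) ≤ σ ^ 2) hσr (sq_nonneg γ) hr hDu hj hb hΛ1
    (by positivity : (0 : ℝ) ≤ ν ^ 2 * r ^ 7)
  have e : lcOf κ ^ 16 * (γ ^ 2 * σ ^ 2 + (σ ^ 2) ^ 2 * phiOf Du r δ ^ 2 + Du ^ 2 / (σ ^ 2 * r ^ 4) +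
      (σ ^ 2) ^ 2 * (ν ^ 2 * r ^ 7) / r ^ 7) =
      (lcOf κ ^ 8 * (γ * σ)) ^ 2 + (lcOf κ ^ 8 * (σ ^ 2 * phiOf Du r δ)) ^ 2 + (lcOf κ ^ 8 * (Du / (σ * r ^ 2))) ^ 2 +
        (lcOf κ ^ 8 * (σ ^ 2 * ν)) ^ 2 := by
    field_simp
  rw [e] at h
  have := sqrt_le_add_four (by positivity) (by positivity) (by positivity) (by positivity) h
  linarith [this]

/-- **`√Θ₂` in the root variables**: `√Θ₂ ≤ L⁹ (γ/σ + Φ + Du/(σ²r²) + σ²ν)`. [folklore] -/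
theorem sqrt_thetaTwo_le {κ σ γ r δ Du j b ν : ℝ} (hκ : 0 < κ) (hκ1 : κ ≤ 1) (hσ : 8 ≤ σ) (hσr : σ ^ 2 ≤ r)
    (hγ : 0 ≤ γ) (hr : 1 ≤ r) (hδ : 0 < δ) (hDu : 0 ≤ Du) (hj : 0 ≤ j) (hb : 0 ≤ b) (hΛ1 : lamOf Du j b ≤ 1)
    (hν : 0 ≤ ν) :
    Real.sqrt (thetaTwoOf κ (σ ^ 2) (γ ^ 2) r δ Du Du j b (ν ^ 2 * r ^ 7)) ≤
      lcOf κ ^ 9 * (γ / σ + phiOf Du r δ + Du / (σ ^ 2 * r ^ 2) + σ ^ 2 * ν) := by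
  have hσ0 : 0 < σ := by linarith
  have hr0 : 0 < r := by linarith
  obtain ⟨hL, -, -⟩ := lcOf_ge hκ hκ1
  have hL0 : 0 ≤ lcOf κ := le_trans (by norm_num) hL
  have hL1 : 1 ≤ lcOf κ := le_trans (by norm_num) hL
  have hΦ0 := phiOf_nonneg hDu hr0 hδ
  have h := thetaTwoOf_le (δ := δ) hκ hκ1 (by nlinarith : (64 : ℝ) ≤ σ ^ 2) hσr (sq_nonneg γ) hr hDu hj hb hΛ1
    (by positivity : (0 : ℝ) ≤ ν ^ 2 * r ^ 7)
  have hS0 : 0 ≤ γ ^ 2 / σ ^ 2 + phiOf Du r δ ^ 2 + Du ^ 2 / ((σ ^ 2) ^ 2 * r ^ 4) + (σ ^ 2) ^ 2 * (ν ^ 2 * r ^ 7) / r ^ 7 := by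
    positivity
  have h17 : lcOf κ ^ 17 ≤ lcOf κ ^ 18 := pow_le_pow_right₀ hL1 (by norm_num)
  have h' : thetaTwoOf κ (σ ^ 2) (γ ^ 2) r δ Du Du j b (ν ^ 2 * r ^ 7) ≤
      lcOf κ ^ 18 * (γ ^ 2 / σ ^ 2 + phiOf Du r δ ^ 2 + Du ^ 2 / ((σ ^ 2) ^ 2 * r ^ 4) + (σ ^ 2) ^ 2 * (ν ^ 2 * r ^ 7) / r ^ 7) :=
    h.trans (mul_le_mul_of_nonneg_right h17 hS0)
  have e : lcOf κ ^ 18 * (γ ^ 2 / σ ^ 2 + phiOf Du r δ ^ 2 + Du ^ 2 / ((σ ^ 2) ^ 2 * r ^ 4) +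
      (σ ^ 2) ^ 2 * (ν ^ 2 * r ^ 7) / r ^ 7) =
      (lcOf κ ^ 9 * (γ / σ)) ^ 2 + (lcOf κ ^ 9 * phiOf Du r δ) ^ 2 + (lcOf κ ^ 9 * (Du / (σ ^ 2 * r ^ 2))) ^ 2 +
        (lcOf κ ^ 9 * (σ ^ 2 * ν)) ^ 2 := by
    field_simp
  rw [e] at h'
  have := sqrt_le_add_four (by positivity) (by positivity) (by positivity) (by positivity) h'
  linarith [this]

/-- `√x ≤ a + b + c` if `x ≤ a² + b² + c²`. [folklore] -/
theorem sqrt_le_add_three {x a b c : ℝ} (ha : 0 ≤ a) (hb : 0 ≤ b) (hc : 0 ≤ c)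
    (h : x ≤ a ^ 2 + b ^ 2 + c ^ 2) : Real.sqrt x ≤ a + b + c := by
  rw [Real.sqrt_le_iff]
  refine ⟨by positivity, h.trans ?_⟩
  nlinarith [mul_nonneg ha hb, mul_nonneg ha hc, mul_nonneg hb hc]

/-- **The base-value bound in the root variables**: `V ≤ L⁸ (γσ³ + σ⁴Φ + σ²Du/r²)`. [folklore] -/
theorem sqrt_vsq_le {κ σ γ r δ Du j b : ℝ} (hκ : 0 < κ) (hκ1 : κ ≤ 1) (hσ : 8 ≤ σ) (hσr : σ ^ 2 ≤ r)
    (hγ : 0 ≤ γ) (hr : 1 ≤ r) (hδ : 0 < δ) (hDu : 0 ≤ Du) (hj : 0 ≤ j) (hb : 0 ≤ b) (hΛ1 : lamOf Du j b ≤ 1) :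
    Real.sqrt (vsqOf κ (σ ^ 2) (γ ^ 2) r δ Du Du j b) ≤
      lcOf κ ^ 8 * (γ * σ ^ 3 + σ ^ 4 * phiOf Du r δ + σ ^ 2 * Du / r ^ 2) := by
  have hσ0 : 0 < σ := by linarith
  have hr0 : 0 < r := by linarith
  obtain ⟨hL, -, -⟩ := lcOf_ge hκ hκ1
  have hL0 : 0 ≤ lcOf κ := le_trans (by norm_num) hL
  have hΦ0 := phiOf_nonneg hDu hr0 hδ
  have h := vsqOf_le (δ := δ) hκ hκ1 (by nlinarith : (64 : ℝ) ≤ σ ^ 2) hσr (sq_nonneg γ) hr hDu hj hb hΛ1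
  have e : lcOf κ ^ 16 * (γ ^ 2 * (σ ^ 2) ^ 3 + (σ ^ 2) ^ 4 * phiOf Du r δ ^ 2 + (σ ^ 2) ^ 2 * Du ^ 2 / r ^ 4) =
      (lcOf κ ^ 8 * (γ * σ ^ 3)) ^ 2 + (lcOf κ ^ 8 * (σ ^ 4 * phiOf Du r δ)) ^ 2 + (lcOf κ ^ 8 * (σ ^ 2 * Du / r ^ 2)) ^ 2 := by
    field_simp
  rw [e] at h
  have := sqrt_le_add_three (by positivity) (by positivity) (by positivity) h
  linarith [this]

/-- **The far-mass bound of `h` in the root variables**: `√J ≤ L⁷ (γ/σ² + Φ/σ + Du/(σr²))`. [folklore] -/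
theorem sqrt_jh_le {κ σ γ r δ Du j b : ℝ} (hκ : 0 < κ) (hκ1 : κ ≤ 1) (hσ : 8 ≤ σ) (hσr : σ ^ 2 ≤ r)
    (hγ : 0 ≤ γ) (hr : 1 ≤ r) (hδ : 0 < δ) (hDu : 0 ≤ Du) (hj : 0 ≤ j) (hb : 0 ≤ b) (hΛ1 : lamOf Du j b ≤ 1) :
    Real.sqrt (jhOf κ (σ ^ 2) (γ ^ 2) r δ Du Du j b) ≤
      lcOf κ ^ 7 * (γ / σ ^ 2 + phiOf Du r δ / σ + Du / (σ * r ^ 2)) := by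
  have hσ0 : 0 < σ := by linarith
  have hr0 : 0 < r := by linarith
  obtain ⟨hL, -, -⟩ := lcOf_ge hκ hκ1
  have hL0 : 0 ≤ lcOf κ := le_trans (by norm_num) hL
  have hL1 : 1 ≤ lcOf κ := le_trans (by norm_num) hL
  have hΦ0 := phiOf_nonneg hDu hr0 hδ
  have h := jhOf_le (δ := δ) hκ hκ1 (by nlinarith : (64 : ℝ) ≤ σ ^ 2) hσr (sq_nonneg γ) hr hDu hj hb hΛ1
  have hS0 : 0 ≤ γ ^ 2 / (σ ^ 2) ^ 2 + phiOf Du r δ ^ 2 / σ ^ 2 + Du ^ 2 / (σ ^ 2 * r ^ 4) := by positivity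
  have h13 : lcOf κ ^ 13 ≤ lcOf κ ^ 14 := pow_le_pow_right₀ hL1 (by norm_num)
  have h' : jhOf κ (σ ^ 2) (γ ^ 2) r δ Du Du j b ≤ lcOf κ ^ 14 * (γ ^ 2 / (σ ^ 2) ^ 2 + phiOf Du r δ ^ 2 / σ ^ 2 + Du ^ 2 / (σ ^ 2 * r ^ 4)) :=
    h.trans (mul_le_mul_of_nonneg_right h13 hS0)
  have e : lcOf κ ^ 14 * (γ ^ 2 / (σ ^ 2) ^ 2 + phiOf Du r δ ^ 2 / σ ^ 2 + Du ^ 2 / (σ ^ 2 * r ^ 4)) =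
      (lcOf κ ^ 7 * (γ / σ ^ 2)) ^ 2 + (lcOf κ ^ 7 * (phiOf Du r δ / σ)) ^ 2 + (lcOf κ ^ 7 * (Du / (σ * r ^ 2))) ^ 2 := by
    field_simp
  rw [e] at h'
  have := sqrt_le_add_three (by positivity) (by positivity) (by positivity) h'
  linarith [this]

/-! ## Stage-2 arithmetic, part 8: the optical jump and the shift -/

-- five coefficient estimates and a long linear combination
set_option maxHeartbeats 400000 in
/-- The optical jump is monotone in its currencies: with `√Θ₁ ≤ s₁`, `√Θ₂ ≤ s₂`, `0 ≤ V ≤ v`, `√J ≤ s_J`,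
`jump ≤ (2.39·10⁸/κ)(s₁ + s₂ + v/ρ⁵ + s_J/ρ²)`. [folklore] -/
theorem jumpOf_le_aux {κ ρ Θ₁ Θ₂ V J s₁ s₂ v sJ : ℝ} (hκ : 0 < κ) (hρ : 64 ≤ ρ)
    (h1 : Real.sqrt Θ₁ ≤ s₁) (h2 : Real.sqrt Θ₂ ≤ s₂) (hV0 : 0 ≤ V) (hV : V ≤ v) (hJ : Real.sqrt J ≤ sJ) :
    jumpOf κ ρ Θ₁ Θ₂ V J ≤ 239000000 / κ * (s₁ + s₂ + v / ρ ^ 5 + sJ / ρ ^ 2) := by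
  have hρ0 : 0 < ρ := by linarith
  have hs₁ : 0 ≤ s₁ := (Real.sqrt_nonneg _).trans h1
  have hs₂ : 0 ≤ s₂ := (Real.sqrt_nonneg _).trans h2
  have hsJ : 0 ≤ sJ := (Real.sqrt_nonneg _).trans hJ
  have hv0 : 0 ≤ v := hV0.trans hV
  have hq : (23 / 25 : ℝ) ^ 3 = 12167 / 15625 := by norm_num
  -- the distance factors
  have hd : (49 / 50) * ρ ≤ ρ - 11 / 10 := by linarith
  have hd0 : 0 ≤ (49 / 50) * ρ := by positivity
  have hd5 : ((49 / 50) * ρ) ^ 5 ≤ (ρ - 11 / 10) ^ 5 := pow_le_pow_left₀ hd0 hd 5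
  have hd4 : ((49 / 50) * ρ) ^ 4 ≤ (ρ - 11 / 10) ^ 4 := pow_le_pow_left₀ hd0 hd 4
  have hρ1 : 0 < ρ - 11 / 10 := by linarith
  -- the five coefficients
  have hA₁ : 38 * (1024 / ((23 / 25 : ℝ) ^ 3 * (23 / 25 : ℝ) ^ 4)) ≤ 69800 := by norm_num
  have hA₂ : 38 * (1024 / ((23 / 25 : ℝ) ^ 3 * (23 / 25 : ℝ) ^ 3)) ≤ 64200 := by norm_num
  have hA₃ : 38 * (1024 / ((23 / 25 : ℝ) ^ 3 * (ρ - 11 / 10) ^ 5)) ≤ 56000 / ρ ^ 5 := by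
    rw [show 38 * (1024 / ((23 / 25 : ℝ) ^ 3 * (ρ - 11 / 10) ^ 5)) = 38 * 1024 / ((23 / 25 : ℝ) ^ 3 * (ρ - 11 / 10) ^ 5) by ring,
      div_le_div_iff₀ (by positivity) (by positivity)]
    have : 38 * 1024 * ρ ^ 5 ≤ 56000 * ((23 / 25 : ℝ) ^ 3 * ((49 / 50) * ρ) ^ 5) := by
      rw [hq]; nlinarith only [pow_nonneg hρ0.le 5]
    rw [hq] at this ⊢; nlinarith only [this, hd5]
  have hA₄ : 38 * (1024 / ((23 / 25 : ℝ) ^ 3 * (ρ - 11 / 10) ^ 4)) ≤ 55000 / ρ ^ 4 := by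
    rw [show 38 * (1024 / ((23 / 25 : ℝ) ^ 3 * (ρ - 11 / 10) ^ 4)) = 38 * 1024 / ((23 / 25 : ℝ) ^ 3 * (ρ - 11 / 10) ^ 4) by ring,
      div_le_div_iff₀ (by positivity) (by positivity)]
    have : 38 * 1024 * ρ ^ 4 ≤ 55000 * ((23 / 25 : ℝ) ^ 3 * ((49 / 50) * ρ) ^ 4) := by
      rw [hq]; nlinarith only [pow_nonneg hρ0.le 4]
    rw [hq] at this ⊢; nlinarith only [this, hd4]
  have hA₅ : 1024 / ((23 / 25 : ℝ) ^ 3 * (ρ - 11 / 10) ^ 5) ≤ (5 / ρ ^ 2) ^ 2 := by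
    rw [show (5 / ρ ^ 2) ^ 2 = 25 / ρ ^ 4 by rw [div_pow]; ring,
      div_le_div_iff₀ (by positivity) (by positivity)]
    have h64 : 64 * ρ ^ 4 ≤ ρ ^ 5 := by nlinarith [pow_nonneg hρ0.le 4]
    have : 1024 * ρ ^ 4 ≤ 25 * ((23 / 25 : ℝ) ^ 3 * ((49 / 50) * ρ) ^ 5) := by
      rw [hq]; nlinarith only [pow_nonneg hρ0.le 4, h64]
    rw [hq] at this ⊢; nlinarith only [this, hd5]
  have hsA₅ : Real.sqrt (1024 / ((23 / 25 : ℝ) ^ 3 * (ρ - 11 / 10) ^ 5)) ≤ 5 / ρ ^ 2 :=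
    Real.sqrt_le_iff.2 ⟨by positivity, hA₅⟩
  have hs39 : Real.sqrt (39 * J) ≤ 25 / 4 * sJ := by
    rw [Real.sqrt_mul (by norm_num)]
    have : Real.sqrt 39 ≤ 25 / 4 := Real.sqrt_le_iff.2 ⟨by norm_num, by norm_num⟩
    exact mul_le_mul this hJ (Real.sqrt_nonneg _) (by norm_num)
  -- term by term
  have hΘ₁0 := Real.sqrt_nonneg Θ₁
  have hΘ₂0 := Real.sqrt_nonneg Θ₂
  have t1 : 38 * (1024 / ((23 / 25 : ℝ) ^ 3 * (23 / 25 : ℝ) ^ 4)) * (12 * Real.sqrt Θ₁) ≤ 69800 * (12 * s₁) :=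
    mul_le_mul hA₁ (by linarith) (by positivity) (by norm_num)
  have t2 : 38 * (1024 / ((23 / 25 : ℝ) ^ 3 * (23 / 25 : ℝ) ^ 3)) * (1428 * Real.sqrt Θ₂) ≤ 64200 * (1428 * s₂) :=
    mul_le_mul hA₂ (by linarith) (by positivity) (by norm_num)
  have t3 : 38 * (1024 / ((23 / 25 : ℝ) ^ 3 * (ρ - 11 / 10) ^ 5)) * (V + 11 / 10 * (12 * Real.sqrt Θ₁)) ≤
      56000 / ρ ^ 5 * (v + 11 / 10 * (12 * s₁)) :=
    mul_le_mul hA₃ (by linarith) (by positivity) (by positivity)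
  have t4 : 38 * (1024 / ((23 / 25 : ℝ) ^ 3 * (ρ - 11 / 10) ^ 4)) * (12 * Real.sqrt Θ₁) ≤ 55000 / ρ ^ 4 * (12 * s₁) :=
    mul_le_mul hA₄ (by linarith) (by positivity) (by positivity)
  have t5 : 38 * Real.sqrt (1024 / ((23 / 25 : ℝ) ^ 3 * (ρ - 11 / 10) ^ 5)) * Real.sqrt (39 * J) ≤ 38 * (5 / ρ ^ 2) * (25 / 4 * sJ) :=
    mul_le_mul (mul_le_mul_of_nonneg_left hsA₅ (by norm_num)) hs39 (Real.sqrt_nonneg _) (by positivity)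
  -- collect
  have hρ4 : 1 / ρ ^ 4 ≤ 1 := by rw [div_le_one (by positivity)]; exact one_le_pow₀ (by linarith)
  have hρ5 : 1 / ρ ^ 5 ≤ 1 := by rw [div_le_one (by positivity)]; exact one_le_pow₀ (by linarith)
  have hsum : 69800 * (12 * s₁) + 64200 * (1428 * s₂) + 56000 / ρ ^ 5 * (v + 11 / 10 * (12 * s₁)) + 55000 / ρ ^ 4 * (12 * s₁) +
      38 * (5 / ρ ^ 2) * (25 / 4 * sJ) ≤ 91677600 * (s₁ + s₂ + v / ρ ^ 5 + sJ / ρ ^ 2) := by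
    have e1 : 56000 / ρ ^ 5 * (v + 11 / 10 * (12 * s₁)) = 56000 * (v / ρ ^ 5) + 739200 * ((1 / ρ ^ 5) * s₁) := by ring
    have e2 : 55000 / ρ ^ 4 * (12 * s₁) = 660000 * ((1 / ρ ^ 4) * s₁) := by ring
    have e3 : 38 * (5 / ρ ^ 2) * (25 / 4 * sJ) = (2375 / 2) * (sJ / ρ ^ 2) := by ring
    rw [e1, e2, e3]
    have i1 : (1 / ρ ^ 5) * s₁ ≤ s₁ := mul_le_of_le_one_left hs₁ hρ5
    have i2 : (1 / ρ ^ 4) * s₁ ≤ s₁ := mul_le_of_le_one_left hs₁ hρ4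
    have hv5 : 0 ≤ v / ρ ^ 5 := by positivity
    have hsJ2 : 0 ≤ sJ / ρ ^ 2 := by positivity
    linarith [i1, i2, hv5, hs₁, hs₂, hsJ2]
  have hS0 : 0 ≤ s₁ + s₂ + v / ρ ^ 5 + sJ / ρ ^ 2 := by positivity
  unfold jumpOf
  have hk : 0 ≤ 2 / κ := by positivity
  calc 2 / κ * (38 * (1024 / ((23 / 25 : ℝ) ^ 3 * (23 / 25 : ℝ) ^ 4)) * (12 * Real.sqrt Θ₁) +
        38 * (1024 / ((23 / 25 : ℝ) ^ 3 * (23 / 25 : ℝ) ^ 3)) * (1428 * Real.sqrt Θ₂) +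
        38 * (1024 / ((23 / 25 : ℝ) ^ 3 * (ρ - 11 / 10) ^ 5)) * (V + 11 / 10 * (12 * Real.sqrt Θ₁)) +
        38 * (1024 / ((23 / 25 : ℝ) ^ 3 * (ρ - 11 / 10) ^ 4)) * (12 * Real.sqrt Θ₁) +
        38 * Real.sqrt (1024 / ((23 / 25 : ℝ) ^ 3 * (ρ - 11 / 10) ^ 5)) * Real.sqrt (39 * J))
      ≤ 2 / κ * (91677600 * (s₁ + s₂ + v / ρ ^ 5 + sJ / ρ ^ 2)) := by
        refine mul_le_mul_of_nonneg_left ?_ hk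
        linarith [t1, t2, t3, t4, t5, hsum]
    _ = 183355200 / κ * (s₁ + s₂ + v / ρ ^ 5 + sJ / ρ ^ 2) := by ring
    _ ≤ 239000000 / κ * (s₁ + s₂ + v / ρ ^ 5 + sJ / ρ ^ 2) :=
        mul_le_mul_of_nonneg_right (div_le_div_of_nonneg_right (by norm_num) hκ.le) hS0

/-- `csLip ≤ 4.6·10⁶` and `cbLip ≤ 9.6·10⁶`. [folklore] -/
theorem csLip_cbLip_le : csLip ≤ 4600000 ∧ cbLip ≤ 9600000 ∧ 0 ≤ csLip ∧ 0 ≤ cbLip := by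
  unfold csLip cbLip
  refine ⟨by norm_num, by norm_num, by positivity, by positivity⟩

/-- Nonnegativity of the optical jump bound (`ρ ≥ 64`, `V ≥ 0`). [folklore] -/
theorem jumpOf_nonneg {κ ρ Θ₁ Θ₂ V J : ℝ} (hκ : 0 < κ) (hρ : 64 ≤ ρ) (hV : 0 ≤ V) : 0 ≤ jumpOf κ ρ Θ₁ Θ₂ V J := by
  have h : 0 < ρ - 11 / 10 := by linarith
  have hκ0 : 0 ≤ 2 / κ := div_nonneg (by norm_num) hκ.le
  unfold jumpOf; positivity

end Summit.AtomisticToContinuum.Crystallization.Theorems.ExcessDecayLiouville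

end
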